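import Literature.NumberTheory.GaloisRepresentations.InertiaRootsOfUnity
import Mathlib.Analysis.Normed.Module.Completion
import Mathlib.Analysis.Normed.Field.Instances
import Mathlib.Topology.Algebra.UniformRing
import Mathlib.Analysis.Normed.Unbundled.SpectralNorm
import Mathlib.Analysis.Normed.Field.Ultra
import HarnessLib

/-!
# The completed algebraic closure `ℂ_F = \widehat{F̄}` of a non-archimedean local field and its
continuous `Γ_F`-action

Let `F` be a non-archimedean local field, `F̄ = AlgebraicClosure F` with the absolute value
`‖·‖ = algNorm F` extending that of `F` (the spectral norm; Neukirch, *ANT* II (4.8);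
`Literature/NumberTheory/GaloisRepresentations/InertiaRootsOfUnity`), and
`Γ_F = Field.absoluteGaloisGroup F`, which acts on `F̄` by isometries (`algNorm_smul`).
This file constructs the first object of Fontaine's period rings (Fontaine, Astérisque 223,
Exp. II §1.1–1.2; Tate 1967 §3; Fontaine–Ouyang §3.1): the field

  `ℂ_F := completion of F̄ for ‖·‖`  (`CompletedAlgClosure F`),

a complete non-archimedean normed field and `F`-algebra, together with the action of `Γ_F` on it
**by isometric (hence continuous) ring automorphisms extending the Galois action on `F̄`**
(`CompletedAlgClosure.instAction`, `smul_coe`, `norm_smul`, `isometry_smul`), commuting with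
the `F`-algebra structure (`instSMulCommClass`, `smul_algebraMap`), and the facts used by the
Ax–Sen–Tate theorem (`Literature/NumberTheory/PAdicHodge/AxSenTate`): `F̄` is dense in `ℂ_F`
(`denseRange_coe`), `F → ℂ_F` is an isometry with closed range (`norm_algebraMap`,
`isClosed_range_algebraMap`).

## Design

* `NormedAlgClosure F` is a TYPE SYNONYM for `AlgebraicClosure F` carrying the `NormedField`
  structure `spectralNorm.normedField F F̄` for the valuation norm
  `IsNonarchimedeanLocalField.nontriviallyNormedField F` of `F` (so `‖x‖ = algNorm F x`,
  `NormedAlgClosure.norm_def`). The tree deliberately declares no normed instance on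
  `AlgebraicClosure F` itself (see `ClosureValuation.lean`: for `F = K_v` Mathlib's own
  `NormedField (v.adicCompletion K)` would give a second, non-defeq path); the synonym keeps that
  discipline while letting Mathlib's `UniformSpace.Completion` machinery run. The `NormedField`
  instance is declared FIRST and the algebraic instances (`Algebra F`, `IsAlgClosure`,
  `MulSemiringAction Γ_F`, …) are transported afterwards with `inferInstanceAs`, so that every
  additive/uniform structure on the synonym is the one underlying the norm.
* `CompletedAlgClosure F := UniformSpace.Completion (NormedAlgClosure F)` (an `abbrev`, exactly as
  Mathlib's `PadicComplex p = UniformSpace.Completion (PadicAlgCl p)`); its `NormedField`,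
  `CompleteSpace` and `Algebra F` instances are Mathlib's. For `F = ℚ_p` this is (isometrically
  isomorphic to) Mathlib's `ℂ_[p]`; we do not identify the two here.
* The action of `σ ∈ Γ_F` on `ℂ_F` is Mathlib's scalar action on a completion
  (`UniformSpace.Completion.instSMul`: `σ • x = Completion.map (σ • ·) x`, available once
  `x ↦ σ • x` is registered as uniformly continuous on `F̄`, `instUniformContinuousConstSMulGal`),
  so that there is ONE `SMul Γ_F ℂ_F` instance; Mathlib supplies `MulAction`, `DistribMulAction`,
  `SMulCommClass Γ_F F ℂ_F` and `ContinuousConstSMul`, and this file adds the multiplicativity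
  (`MulSemiringAction`, by density) and the isometry property. `galRingHom σ` is the resulting
  ring endomorphism `x ↦ σ • x` (`= Completion.mapRingHom` of `x ↦ σ • x`, `galRingHom_eq_mapRingHom`).

## What is NOT here

* No statement about the fixed field `ℂ_F^{Γ_F}` (Ax–Sen–Tate: it is `F` when `char F = 0`) —
  that is `AxSenTate.lean`; no Tate twists `ℂ_F(i)`, no `B_HT`, no continuity of the action map
  `Γ_F × ℂ_F → ℂ_F` in the first variable (true, not needed yet).

## References

* J.-M. Fontaine, *Le corps des périodes p-adiques*, Astérisque 223 (1994), Exp. II, §1.1–1.2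
  (`C = \widehat{K̄}` with its continuous `G_K`-action). [FontaineAsterisque223III]
* J. Tate, *p-divisible groups*, Proc. Conf. Local Fields (Driebergen 1966), Springer 1967, §3
  ("the completion `C` of the algebraic closure"). [Tate1967]
* J.-M. Fontaine, Y. Ouyang, *Theory of p-adic Galois representations*, §3.1 (the field `C`).
  [FontaineOuyang2022]
* J. Neukirch, *Algebraic Number Theory*, Ch. II (4.8) (the absolute value of `F̄`). [NeukirchANT1999]
-/

noncomputable section

open ValuativeRel Field UniformSpace

namespace Literature.NumberTheory.PAdicHodge

open Literature.NumberTheory.GaloisRepresentations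
open Literature.NumberTheory.GaloisRepresentations.IsNonarchimedeanLocalField

variable (F : Type) [Field F] [ValuativeRel F] [TopologicalSpace F] [IsNonarchimedeanLocalField F]

/-! ### `F̄` as a normed field -/

/-- **`F̄` with its absolute value**: a type synonym for `AlgebraicClosure F` carrying the normed
field structure of the spectral norm `algNorm F` (the unique extension of the absolute value of
the complete field `F`; Neukirch, *ANT*, Ch. II, Thm. (4.8)).
[cite: NeukirchANT1999, Ch. II (4.8)] -/
def NormedAlgClosure : Type := AlgebraicClosure F

namespace NormedAlgClosure

/-- The normed field structure on `F̄`: Mathlib's `spectralNorm.normedField` for the valuation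
norm `nontriviallyNormedField F` of `F`. Declared before every other instance on the synonym (see
the module docstring). [cite: NeukirchANT1999, Ch. II (4.8)] -/
instance instNormedField : NormedField (NormedAlgClosure F) :=
  letI := nontriviallyNormedField F
  spectralNorm.normedField F (AlgebraicClosure F)

/-- `F̄` is an `F`-algebra (transport from `AlgebraicClosure F`). [folklore] -/
instance instAlgebra : Algebra F (NormedAlgClosure F) :=
  inferInstanceAs (Algebra F (AlgebraicClosure F))

/-- `F̄/F` is algebraic (transport). [folklore] -/
instance instIsAlgebraic : Algebra.IsAlgebraic F (NormedAlgClosure F) :=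
  inferInstanceAs (Algebra.IsAlgebraic F (AlgebraicClosure F))

/-- `F̄` is algebraically closed (transport). [folklore] -/
instance instIsAlgClosed : IsAlgClosed (NormedAlgClosure F) :=
  inferInstanceAs (IsAlgClosed (AlgebraicClosure F))

/-- `F̄` is an algebraic closure of `F` (transport); in particular `F̄/F` is normal. [folklore] -/
instance instIsAlgClosure : IsAlgClosure F (NormedAlgClosure F) :=
  inferInstanceAs (IsAlgClosure F (AlgebraicClosure F))

/-- The Galois action of `Γ_F = Gal(F̄/F)` on `F̄` (transport of the tree's
`Field.absoluteGaloisGroup.instMulSemiringActionAlgebraicClosure`).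
[cite: NeukirchANT1999, Ch. IV §1] -/
instance instAction : MulSemiringAction (absoluteGaloisGroup F) (NormedAlgClosure F) :=
  inferInstanceAs (MulSemiringAction (absoluteGaloisGroup F) (AlgebraicClosure F))

/-- The Galois action is `F`-linear (transport). [folklore] -/
instance instSMulCommClass : SMulCommClass (absoluteGaloisGroup F) F (NormedAlgClosure F) :=
  inferInstanceAs (SMulCommClass (absoluteGaloisGroup F) F (AlgebraicClosure F))

variable {F}

/-- The identification `NormedAlgClosure F = AlgebraicClosure F` as an `F`-algebra isomorphism
(the identity map). [folklore] -/
def toAlgClosure : NormedAlgClosure F ≃ₐ[F] AlgebraicClosure F := AlgEquiv.refl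

/-- The norm of `F̄` IS the tree's `algNorm F` (by construction). [cite: NeukirchANT1999, Ch. II (4.8)] -/
theorem norm_def (x : NormedAlgClosure F) : ‖x‖ = algNorm F (toAlgClosure x) := rfl

/-- The Galois action on the synonym is the Galois action on `AlgebraicClosure F`. [folklore] -/
theorem toAlgClosure_smul (σ : absoluteGaloisGroup F) (x : NormedAlgClosure F) :
    toAlgClosure (σ • x) = σ • toAlgClosure x := rfl

/-- `σ • x = σ(x)` for the underlying `F`-algebra automorphism `toAlgEquiv F σ` of `F̄`. [folklore] -/
theorem smul_eq_toAlgEquiv (σ : absoluteGaloisGroup F) (x : NormedAlgClosure F) :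
    toAlgClosure (σ • x) = absoluteGaloisGroup.toAlgEquiv F σ (toAlgClosure x) := rfl

/-- Every `F`-algebra automorphism of `F̄` is the action of an element of `Γ_F`. [folklore] -/
theorem exists_smul_eq_of_algEquiv (s : NormedAlgClosure F ≃ₐ[F] NormedAlgClosure F) :
    ∃ σ : absoluteGaloisGroup F, ∀ x : NormedAlgClosure F, σ • x = s x :=
  ⟨(absoluteGaloisGroup.toAlgEquiv F).symm (show AlgebraicClosure F ≃ₐ[F] AlgebraicClosure F from s),
    fun _ => rfl⟩

/-- **`Γ_F` acts on `F̄` by isometries**: `‖σ • x‖ = ‖x‖` (tree `algNorm_smul`; Neukirch II (4.8),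
uniqueness of the extended absolute value). [cite: NeukirchANT1999, Ch. II (4.8)] -/
theorem norm_smul (σ : absoluteGaloisGroup F) (x : NormedAlgClosure F) : ‖σ • x‖ = ‖x‖ :=
  algNorm_smul σ (toAlgClosure x)

/-- The metric of `F̄` is ultrametric (tree `algNorm_add_le`). [cite: NeukirchANT1999, Ch. II (4.8)] -/
instance instIsUltrametricDist : IsUltrametricDist (NormedAlgClosure F) :=
  IsUltrametricDist.isUltrametricDist_of_forall_norm_add_le_max_norm
    (fun x y => algNorm_add_le (F := F) (toAlgClosure x) (toAlgClosure y))

/-- Each `σ ∈ Γ_F` is an isometry of `F̄`. [cite: NeukirchANT1999, Ch. II (4.8)] -/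
theorem isometry_smul (σ : absoluteGaloisGroup F) :
    Isometry (fun x : NormedAlgClosure F => σ • x) :=
  AddMonoidHomClass.isometry_of_norm (MulSemiringAction.toRingHom _ (NormedAlgClosure F) σ)
    (fun x => norm_smul σ x)

/-- Each `σ ∈ Γ_F` is uniformly continuous on `F̄`. [folklore] -/
theorem uniformContinuous_smul (σ : absoluteGaloisGroup F) :
    UniformContinuous (fun x : NormedAlgClosure F => σ • x) :=
  (isometry_smul σ).uniformContinuous

/-- The Galois action on `F̄` is by uniformly continuous maps (instance form of
`uniformContinuous_smul`; this is what makes Mathlib's action of `Γ_F` on the completion `ℂ_F`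
available). [folklore] -/
instance instUniformContinuousConstSMulGal :
    UniformContinuousConstSMul (absoluteGaloisGroup F) (NormedAlgClosure F) :=
  ⟨uniformContinuous_smul⟩

/-- Scalar multiplication by `c ∈ F` (i.e. multiplication by `c`) is continuous on `F̄`. [folklore] -/
instance instContinuousConstSMul : ContinuousConstSMul F (NormedAlgClosure F) :=
  ⟨fun c => by
    have : (fun x : NormedAlgClosure F => c • x) = fun x => algebraMap F _ c * x := by
      funext x; exact Algebra.smul_def c x
    rw [this]
    exact continuous_const_mul _⟩

/-- Scalar multiplication by `c ∈ F` is uniformly continuous on `F̄` (needed for Mathlib's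
`Algebra F (UniformSpace.Completion F̄)`). [folklore] -/
instance instUniformContinuousConstSMul : UniformContinuousConstSMul F (NormedAlgClosure F) :=
  uniformContinuousConstSMul_of_continuousConstSMul F (NormedAlgClosure F)

/-- The norm of `F̄` extends the valuation norm of `F` (tree `algNorm_algebraMap`).
[cite: NeukirchANT1999, Ch. II (4.8)] -/
theorem norm_algebraMap (c : F) :
    ‖algebraMap F (NormedAlgClosure F) c‖ = (letI := nontriviallyNormedField F; ‖c‖) :=
  algNorm_algebraMap c

/-- `Γ_F` fixes `F ⊆ F̄`. [folklore] -/
theorem smul_algebraMap (σ : absoluteGaloisGroup F) (c : F) :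
    σ • algebraMap F (NormedAlgClosure F) c = algebraMap F (NormedAlgClosure F) c :=
  _root_.smul_algebraMap σ (show F from c)

end NormedAlgClosure

/-! ### `ℂ_F` -/

/-- **The field `ℂ_F`**: the completion of `F̄` for its absolute value (Tate 1967 §3; Fontaine,
Astérisque 223, Exp. II §1.1: `C = \widehat{K̄}`). A complete non-archimedean normed field and an
`F`-algebra (Mathlib's instances on `UniformSpace.Completion`).
[cite: Tate1967, §3] [cite: FontaineOuyang2022, §3.1] -/
abbrev CompletedAlgClosure : Type := UniformSpace.Completion (NormedAlgClosure F)

namespace CompletedAlgClosure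

/-- `ℂ_F` is ultrametric (a normed algebra over the ultrametric field `F̄`; Mathlib
`IsUltrametricDist.of_normedAlgebra`, as for `ℂ_[p]`). [folklore] -/
instance instIsUltrametricDist : IsUltrametricDist (CompletedAlgClosure F) :=
  IsUltrametricDist.of_normedAlgebra (NormedAlgClosure F)

variable {F}

/-- Unfolding of Mathlib's action of `Γ_F` on the completion: `σ • x = Completion.map (σ • ·) x`
(the extension by continuity of the isometry `x ↦ σ • x` of `F̄`). [cite: FontaineOuyang2022, §3.1] -/
theorem smul_eq_map (σ : absoluteGaloisGroup F) (x : CompletedAlgClosure F) :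
    σ • x = Completion.map (fun y : NormedAlgClosure F => σ • y) x := rfl

/-- **The action on `ℂ_F` extends the Galois action on `F̄`**: `σ • ↑x = ↑(σ • x)`.
[cite: FontaineOuyang2022, §3.1] -/
theorem smul_coe (σ : absoluteGaloisGroup F) (x : NormedAlgClosure F) :
    σ • (x : CompletedAlgClosure F) = ((σ • x : NormedAlgClosure F) : CompletedAlgClosure F) :=
  (Completion.coe_smul σ x).symm

/-- Each `σ ∈ Γ_F` acts continuously on `ℂ_F`. [cite: Tate1967, §3] -/
theorem continuous_constSMul (σ : absoluteGaloisGroup F) :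
    Continuous (fun x : CompletedAlgClosure F => σ • x) :=
  continuous_const_smul σ

/-- `Γ_F` acts on `ℂ_F` through continuous maps (Mathlib's instance, recorded under a name).
[cite: Tate1967, §3] -/
instance instContinuousConstSMul :
    ContinuousConstSMul (absoluteGaloisGroup F) (CompletedAlgClosure F) :=
  inferInstance

/-- **The continuous action of `Γ_F` on `ℂ_F` by ring automorphisms** (Tate 1967 §3; Fontaine,
Exp. II §1.1): Mathlib's `DistribMulAction` of `Γ_F` on the completion, which is moreover
multiplicative — the identities `σ • 1 = 1`, `σ • (x y) = (σ • x)(σ • y)` hold on the dense subfield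
`F̄` and pass to `ℂ_F` by continuity. [cite: Tate1967, §3] [cite: FontaineOuyang2022, §3.1] -/
instance instAction : MulSemiringAction (absoluteGaloisGroup F) (CompletedAlgClosure F) where
  __ := (inferInstance : DistribMulAction (absoluteGaloisGroup F) (CompletedAlgClosure F))
  smul_one σ := by
    rw [← Completion.coe_one, smul_coe, smul_one]
  smul_mul σ x y := by
    refine Completion.induction_on₂ x y
      (isClosed_eq ((continuous_constSMul σ).comp continuous_mul)
        (((continuous_constSMul σ).comp continuous_fst).mul
          ((continuous_constSMul σ).comp continuous_snd))) ?_
    intro a b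
    rw [← Completion.coe_mul, smul_coe, smul_coe, smul_coe, ← Completion.coe_mul, smul_mul']

/-- The action of `σ ∈ Γ_F` on `ℂ_F` as a ring homomorphism `x ↦ σ • x`.
[cite: FontaineOuyang2022, §3.1] -/
def galRingHom (σ : absoluteGaloisGroup F) : CompletedAlgClosure F →+* CompletedAlgClosure F :=
  MulSemiringAction.toRingHom _ (CompletedAlgClosure F) σ

/-- Unfolding: `σ • x = galRingHom σ x`. [folklore] -/
theorem smul_def (σ : absoluteGaloisGroup F) (x : CompletedAlgClosure F) :
    σ • x = galRingHom σ x := rfl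

/-- `galRingHom σ` extends the Galois action on `F̄`. [folklore] -/
theorem galRingHom_coe (σ : absoluteGaloisGroup F) (x : NormedAlgClosure F) :
    galRingHom σ (x : CompletedAlgClosure F) =
      ((σ • x : NormedAlgClosure F) : CompletedAlgClosure F) :=
  smul_coe σ x

/-- `galRingHom σ` is continuous. [folklore] -/
theorem continuous_galRingHom (σ : absoluteGaloisGroup F) : Continuous (galRingHom σ) :=
  continuous_constSMul σ

/-- `galRingHom σ` is Mathlib's `UniformSpace.Completion.mapRingHom` of the (continuous) ring
automorphism `x ↦ σ • x` of `F̄`. [folklore] -/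
theorem galRingHom_eq_mapRingHom (σ : absoluteGaloisGroup F) :
    galRingHom σ = Completion.mapRingHom
      (MulSemiringAction.toRingHom _ (NormedAlgClosure F) σ)
      (NormedAlgClosure.uniformContinuous_smul σ).continuous :=
  RingHom.ext fun _ => rfl

/-- `F → ℂ_F` factors through `F̄`: `algebraMap F ℂ_F c = ↑(algebraMap F F̄ c)` (Mathlib's
definition of the algebra structure on a completion). [folklore] -/
theorem algebraMap_eq_coe (c : F) :
    algebraMap F (CompletedAlgClosure F) c =
      ((algebraMap F (NormedAlgClosure F) c : NormedAlgClosure F) : CompletedAlgClosure F) :=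
  rfl

/-- **`Γ_F` acts on `ℂ_F` by isometries**: `‖σ • x‖ = ‖x‖` (by density from `F̄`).
[cite: FontaineOuyang2022, §3.1] -/
theorem norm_smul (σ : absoluteGaloisGroup F) (x : CompletedAlgClosure F) : ‖σ • x‖ = ‖x‖ := by
  refine Completion.induction_on x
    (isClosed_eq (continuous_norm.comp (continuous_constSMul σ)) continuous_norm) ?_
  intro a
  rw [smul_coe, Completion.norm_coe, Completion.norm_coe, NormedAlgClosure.norm_smul]

/-- Each `σ ∈ Γ_F` is an isometry of `ℂ_F`. [cite: FontaineOuyang2022, §3.1] -/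
theorem isometry_smul (σ : absoluteGaloisGroup F) :
    Isometry (fun x : CompletedAlgClosure F => σ • x) :=
  AddMonoidHomClass.isometry_of_norm (galRingHom σ) (norm_smul σ)

/-- `Γ_F` fixes `F ⊆ ℂ_F`. [folklore] -/
theorem smul_algebraMap (σ : absoluteGaloisGroup F) (c : F) :
    σ • algebraMap F (CompletedAlgClosure F) c = algebraMap F (CompletedAlgClosure F) c := by
  rw [algebraMap_eq_coe, smul_coe, NormedAlgClosure.smul_algebraMap]

/-- The action of `Γ_F` on `ℂ_F` is `F`-linear (Mathlib's instance for completions, from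
`NormedAlgClosure.instSMulCommClass`; recorded under a name). [folklore] -/
instance instSMulCommClass :
    SMulCommClass (absoluteGaloisGroup F) F (CompletedAlgClosure F) :=
  inferInstance

/-- `F`-embeddings fix `F`: the fixed points of `Γ_F` in `ℂ_F` contain (the image of) `F` — the easy
inclusion of Ax–Sen–Tate. [folklore] -/
theorem range_algebraMap_subset_fixedPoints :
    Set.range (algebraMap F (CompletedAlgClosure F)) ⊆
      {x : CompletedAlgClosure F | ∀ σ : absoluteGaloisGroup F, σ • x = x} := by
  rintro _ ⟨c, rfl⟩ σ
  exact smul_algebraMap σ c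

/-- `F → ℂ_F` is norm-preserving (for the valuation norm of `F`). [cite: NeukirchANT1999, Ch. II (4.8)] -/
theorem norm_algebraMap (c : F) :
    ‖algebraMap F (CompletedAlgClosure F) c‖ = (letI := nontriviallyNormedField F; ‖c‖) := by
  rw [algebraMap_eq_coe, Completion.norm_coe, NormedAlgClosure.norm_algebraMap]

/-- `F → ℂ_F` is an isometry (for the valuation norm of `F`). [folklore] -/
theorem isometry_algebraMap :
    letI := nontriviallyNormedField F
    Isometry (algebraMap F (CompletedAlgClosure F)) := by
  letI := nontriviallyNormedField F
  exact AddMonoidHomClass.isometry_of_norm (algebraMap F (CompletedAlgClosure F)) norm_algebraMap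

/-- **`F` is closed in `ℂ_F`** (`F` is complete and `F → ℂ_F` is an isometry). [folklore] -/
theorem isClosed_range_algebraMap :
    IsClosed (Set.range (algebraMap F (CompletedAlgClosure F))) := by
  letI := nontriviallyNormedField F
  exact (isometry_algebraMap (F := F)).isUniformInducing.isComplete_range.isClosed

/-- `F̄` is dense in `ℂ_F`. [folklore] -/
theorem denseRange_coe : DenseRange ((↑) : NormedAlgClosure F → CompletedAlgClosure F) :=
  Completion.denseRange_coe

end CompletedAlgClosure

end Literature.NumberTheory.PAdicHodge

end
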